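import Summits.Langlands.Langlands.Theses.OrdinaryPrimeTransport

/-!
# Birth skeleton — crux `PrimeRankTransport` (stmt-Langlands-17213) of route OrdinaryPrimeTransport

Line `birth` (skeleton-register, BC3): the crux
`Summit.Langlands.Langlands.Theses.OrdinaryPrimeTransport.PrimeRankTransport`
("irreducible at ONE prime (ℓ₀, ι₀) ⇒ irreducible at EVERY (ℓ, ι)", prime rank `p ≥ 3`,
`K` totally real or CM, `π` cuspidal L-algebraic with regular infinity type, not essentially
self-dual at Satake level) is assembled from three named stubs along the route's own proof line
(torus case / Lie-irreducible case, route header TWO-LAYER PLAN) plus the existence of a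
compatible partner at the good prime, which the crux as typed needs because its hypothesis
`∃ ℓ₀ ι₀, ∀ ρ₀ compatible → irreducible` is silent about whether an avatar exists at `(ℓ₀, ι₀)`
(refuter note OPT-review.md, 2026-08-16):

* `stub_avatarExists` — an L-normalised Satake–Frobenius-compatible avatar exists at EVERY
  `(ℓ, ι)` (Harris–Lan–Taylor–Thorne 2016 Thm. A / Scholze 2015 / Varma 2024 in the tree's
  C-normalised form `Literature.NumberTheory.Automorphic.exists_galoisRep_of_regularAlgebraic`,
  twisted by `ε_ℓ^{(p-1)/2}` — an integral power because `p` is odd, which is also why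
  L-algebraic = C-algebraic here; plus `hasSatakeParamAt_cofinite`).
* `stub_torusCaseTransport` — the potentially-reducible branch: if a compatible irreducible `ρ₀`
  at some `(ℓ₀, ι₀)` becomes reducible on some open subgroup `Γ_{F'}`, then (Clifford with `p`
  prime; Hodge–Tate regularity kills the isotypic sub-case) `ρ₀ ≅ Ind_{K'}^{K} χ₀` for a degree-`p`
  extension `K'/K` and a locally algebraic `χ₀`, i.e. the avatar of an algebraic Hecke character
  of `K'` (Serre, *Abelian ℓ-adic representations* III; Henniart/Waldschmidt); its `(ℓ, ι)`-adic
  companions give `ρ^ss ≅ Ind χ_{ℓ,ι}` for every compatible `ρ` (Chebotarev + Brauer–Nesbitt),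
  irreducible by Mackey's criterion, which reads the same on the Hecke characters at every prime.
* `stub_lieIrreducibleTransport` — the heart (Hui transport in prime rank): if `ρ₀` is
  irreducible on every open subgroup, Hodge–Tate regularity (AHTW 2026 Thm. 1.2.1, vendored
  `AHTW2026.deRham_hodgeTateRegular`; CM quadratic base change for totally real `K`) makes the
  tautological representation of the simple group `(G⁰_{λ₀})^der` weight-multiplicity-free of
  prime dimension, hence `SL_p` (standard or dual), `Sym^{p-1} SL_2`, `SO_p` or `G_2` (`p = 7`);
  the last three are orthogonal and force `ρ₀ ≅ ρ₀^∨ ⊗ c` with `c` de Rham, i.e. `π` essentially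
  self-dual at Satake level — excluded; so `(G⁰_{λ₀})^der = SL_p` of semisimple rank `p - 1`,
  which is `λ`-independent for the `ℚ(π)`-rational compatible pair `(ρ₀, ρ^ss)`
  (Hui, MRL 20 (2013) = arXiv:1204.5271 Thm. 3.19 / Rem. 1.8; Serre's Frobenius tori), while a
  reducible `ρ^ss ⊂ GL_k × GL_{p-k}` has semisimple rank `≤ p - 2`.

`PrimeRankTransport_of_stubs : <stub₁-sig> → <stub₂-sig> → <stub₃-sig> → <body of the crux>` is
the kernel-checked glue (REAL proof: get `ρ₀` at the good prime from stub 1, it is irreducible by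
the crux hypothesis, split on Lie-irreducibility), and
`PrimeRankTransport_of : PrimeRankTransport := PrimeRankTransport_of_stubs stub₁ stub₂ stub₃`
concludes the crux BY NAME (registrar shape, as `#h21_check_skeleton` requires: no hypotheses other
than registered obligations). `sorry` occurs ONLY in the three `stub_*` theorems.

BC3 (planner folder `bc/*_probe*.lean`, 2026-08-17, farm): for each stub statement `S`,
`example : S → PrimeRankTransport` and `example : S → Langlands` by
`first | exact? | simpa [S] | (unfold S; simpa) | aesop` (400000 heartbeats) FAIL, 6/6 — split runs:
`exact?` "could not close the goal", `aesop` "failed to prove the goal after exhaustive search",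
`simpa` "assumption failed" (stub 1) / heartbeat exhaustion (stubs 2, 3): no stub is cheaply the crux
or the summit (no shredding / costume).

Disproof used: none exists for this crux (`ledger crux ls stmt-Langlands-17213`: no workfiles before
this line, 2026-08-17). Negatives index (Langlands): the K3 Serre-type anchor entry — unrelated.
-/

set_option linter.dupNamespace false

namespace Summit.Langlands.Langlands.Cruxes.PrimeRankTransport.Birth

open Summit.Langlands.Langlands.Theses.OrdinaryPrimeTransport

/-- **Stub 1 (existence of the compatible partner at every prime; HLTT/Scholze/Varma in
L-normalisation).** For `K` totally real or CM, `p ≥ 3` prime, `π` cuspidal L-algebraic on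
`GL_p(𝔸_K)` with regular infinity type: at every `(ℓ, ι)` there is a framed
`ρ : Γ_K → GL_p(ℚ̄_ℓ)` Satake–Frobenius compatible with `(π, ι)` at almost all places.
Proof line: `p` odd ⇒ the L-algebraic infinity type is C-algebraic, so `π` is regular algebraic;
`exists_galoisRep_of_regularAlgebraic` gives `r` with arithmetic-Frobenius polynomial
`arithFrobPolyOfSatake ι q_v p α` at every unramified `v ∤ ℓ`; `ρ := r ⊗ ε_ℓ^{(p-1)/2}` has
`arithFrobPolyOfSatake ι q_v 1 α`; `hasSatakeParamAt_cofinite` makes the exceptional set finite.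
Size M given the vendored facts (XL unconditionally). -/
theorem stub_avatarExists :
    ∀ (K : Type) [Field K] [NumberField K], (NumberField.IsTotallyReal K ∨ NumberField.IsCMField K) → ∀ (p : ℕ), Nat.Prime p → 3 ≤ p → ∀ (hcpt : Literature.NumberTheory.Automorphic.isCompact_glFiniteIntegralLevel p K) (π : Literature.NumberTheory.Automorphic.CuspidalAutomorphicRepData p K hcpt), π.1.IsLAlgebraic → (∃ T : Literature.NumberTheory.Automorphic.InfinityType K p, π.1.HasInfinityType T ∧ T.IsRegular) → ∀ (ℓ : ℕ) [Fact ℓ.Prime] (ι : PadicAlgCl ℓ ≃+* ℂ), ∃ ρ : Literature.NumberTheory.GaloisRepresentations.FramedGaloisRep K (PadicAlgCl ℓ) p, ∀ᶠ v : IsDedekindDomain.HeightOneSpectrum (NumberField.RingOfIntegers K) in Filter.cofinite, Summit.Langlands.SatakeFrobCompatibleAt ι π.1 ρ v := by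
  sorry

/-- **Stub 2 (torus / potentially-reducible branch; Serre–Clifford–Mackey).** Same sector
(non-self-duality not needed). If a compatible IRREDUCIBLE avatar `ρ₀` at some `(ℓ₀, ι₀)` is NOT
Lie-irreducible — its restriction to `Γ_{F'}` is reducible for some number field `F' ⊇ K` — then
every compatible avatar at every `(ℓ, ι)` is irreducible.  Proof line: Clifford for the Galois
closure and `p` prime ⇒ `ρ₀|_{Γ_{F''}}` is a sum of `p` conjugate characters, pairwise distinct
(the isotypic sub-case contradicts Hodge–Tate regularity, AHTW Thm. 1.2.1) ⇒ `ρ₀ ≅ Ind_{K'}^K χ₀`,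
`[K' : K] = p`, `χ₀` Hodge–Tate hence locally algebraic, the `λ₀`-adic avatar of an algebraic
Hecke character `χ` of `K'`; the `(ℓ, ι)`-avatar `χ_{ℓ,ι}` gives `Ind χ_{ℓ,ι}` with the same
complex Frobenius polynomials a.e., so `ρ^ss ≅ Ind χ_{ℓ,ι}` (Chebotarev, Brauer–Nesbitt:
`nonempty_equiv_of_hasFrobCharpolyAt_eventually`), irreducible by Mackey's criterion, which holds
at `ℓ` iff it holds at `ℓ₀` (it is a statement about `χ` and its conjugates). Size L. -/
theorem stub_torusCaseTransport :
    ∀ (K : Type) [Field K] [NumberField K], (NumberField.IsTotallyReal K ∨ NumberField.IsCMField K) → ∀ (p : ℕ), Nat.Prime p → 3 ≤ p → ∀ (hcpt : Literature.NumberTheory.Automorphic.isCompact_glFiniteIntegralLevel p K) (π : Literature.NumberTheory.Automorphic.CuspidalAutomorphicRepData p K hcpt), π.1.IsLAlgebraic → (∃ T : Literature.NumberTheory.Automorphic.InfinityType K p, π.1.HasInfinityType T ∧ T.IsRegular) → ∀ (ℓ₀ : ℕ) [Fact ℓ₀.Prime] (ι₀ : PadicAlgCl ℓ₀ ≃+*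 ℂ) (ρ₀ : Literature.NumberTheory.GaloisRepresentations.FramedGaloisRep K (PadicAlgCl ℓ₀) p), (∀ᶠ v : IsDedekindDomain.HeightOneSpectrum (NumberField.RingOfIntegers K) in Filter.cofinite, Summit.Langlands.SatakeFrobCompatibleAt ι₀ π.1 ρ₀ v) → ρ₀.toGaloisRep.IsIrreducible → ¬ (∀ (F' : Type) [Field F'] [NumberField F'] [Algebra K F'], (ρ₀.restrictField F').toGaloisRep.IsIrreducible) → ∀ (ℓ : ℕ) [Fact ℓ.Prime] (ι : PadicAlgCl ℓ ≃+* ℂ) (ρ : Literature.NumberTheory.GaloisRepresentations.FramedGaloisRep K (PadicAlgCl ℓ) p), (∀ᶠ v : IsDedekindDomain.HeightOneSpectrum (NumberField.RingOfIntegers K) in Filter.cofinite, Summit.Langlands.SatakeFrobCompatibleAt ι π.1 ρ v) → ρ.toGaloisRep.IsIrreducible := by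
  sorry

/-- **Stub 3 (Lie-irreducible branch; the heart — Hui's semisimple-rank transport in prime
rank).** Full sector including non-essential-self-duality at Satake level. If a compatible
irreducible avatar `ρ₀` at some `(ℓ₀, ι₀)` stays irreducible on `Γ_{F'}` for EVERY number field
`F' ⊇ K`, then every compatible avatar at every `(ℓ, ι)` is irreducible.  Proof line:
`G⁰_{λ₀}` acts irreducibly, so `(G⁰_{λ₀})^der` is almost simple acting irreducibly in prime
dimension; Hodge–Tate regularity (AHTW Thm. 1.2.1 over CM, after a CM quadratic base change when
`K` is totally real; Sen) makes the representation weight-multiplicity-free, so by the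
classification of multiplicity-free irreducibles (Howe) it is `SL_p` std/dual, `Sym^{p-1} SL_2`,
`SO_p` or `G_2` (`p = 7`); the last three preserve a symmetric form, whence `ρ₀ ≅ ρ₀^∨ ⊗ c` with
`c` de Rham = avatar of an algebraic Hecke character, i.e. `t_π⁻¹ = η · t_π` a.e. — excluded by
hypothesis; so `(G⁰_{λ₀})^der = SL_p`, semisimple rank `p - 1`. The pair `(ρ₀, ρ^ss)` is a
`ℚ(π)`-rational compatible pair (Clozel: `ℚ(π)` is a number field; `p` odd so no `√q`), and the
semisimple rank of `(G⁰_λ)^der` is `λ`-independent (Hui 2013 Thm. 3.19 + Rem. 1.8, via Serre's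
Frobenius tori), whereas reducible `ρ^ss ⊂ GL_k × GL_{p-k}` has semisimple rank `≤ p - 2`.
Size L (why it might fail: Hui 3.19 for an E-rational PAIR rather than a full ℚ-rational system;
completeness of the prime-dimensional multiplicity-free list for non-connected `G`). -/
theorem stub_lieIrreducibleTransport :
    ∀ (K : Type) [Field K] [NumberField K], (NumberField.IsTotallyReal K ∨ NumberField.IsCMField K) → ∀ (p : ℕ), Nat.Prime p → 3 ≤ p → ∀ (hcpt : Literature.NumberTheory.Automorphic.isCompact_glFiniteIntegralLevel p K) (π : Literature.NumberTheory.Automorphic.CuspidalAutomorphicRepData p K hcpt), π.1.IsLAlgebraic → (∃ T : Literature.NumberTheory.Automorphic.InfinityType K p, π.1.HasInfinityType T ∧ T.IsRegular) → (∀ (h1 : Literature.NumberTheory.Automorphic.isCompact_glFiniteIntegralLevel 1 K) (η : Literature.NumberTheory.Automorphic.CuspidalAutomorphicRepData 1 K h1), ¬ (∀ᶠ v : IsDedekindDomain.HeightOneSpectrum (NumberField.RingOfIntegers K) in Filter.cofinite, ∀ α : Multiset ℂ, π.1.HasSatakeParamAt v α → ∃ e : ℂ, η.1.HasSatakeParamAt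 v {e} ∧ α.map (fun a => a⁻¹) = α.map (fun a => e * a))) → ∀ (ℓ₀ : ℕ) [Fact ℓ₀.Prime] (ι₀ : PadicAlgCl ℓ₀ ≃+* ℂ) (ρ₀ : Literature.NumberTheory.GaloisRepresentations.FramedGaloisRep K (PadicAlgCl ℓ₀) p), (∀ᶠ v : IsDedekindDomain.HeightOneSpectrum (NumberField.RingOfIntegers K) in Filter.cofinite, Summit.Langlands.SatakeFrobCompatibleAt ι₀ π.1 ρ₀ v) → ρ₀.toGaloisRep.IsIrreducible → (∀ (F' : Type) [Field F'] [NumberField F'] [Algebra K F'], (ρ₀.restrictField F').toGaloisRep.IsIrreducible) → ∀ (ℓ : ℕ) [Fact ℓ.Prime] (ι : PadicAlgCl ℓ ≃+* ℂ) (ρ : Literature.NumberTheory.GaloisRepresentations.FramedGaloisRep K (PadicAlgCl ℓ) p), (∀ᶠ v : IsDedekindDomain.HeightOneSpectrum (NumberField.RingOfIntegers K) in Filter.cofinite, Summit.Langlands.SatakeFrobCompatibleAt ι π.1 ρ v) → ρ.toGaloisRep.IsIrreducible := by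
  sorry

/-- **ASSEMBLY (kernel-checked, no `sorry`).** The three stub statements imply the crux statement —
verbatim the body of `Summit.Langlands.Langlands.Theses.OrdinaryPrimeTransport.PrimeRankTransport`
(concluded as its body, not by name, so that the registrar's skeleton theorem below is the unique
declaration concluding the crux BY NAME). Fix the sector data and the good prime `(ℓ₀, ι₀)` of the
crux hypothesis; `hEx` supplies a compatible `ρ₀` there, irreducible by that hypothesis; if `ρ₀` is
Lie-irreducible use `hLie`, else `hTorus`. [folklore] -/
theorem PrimeRankTransport_of_stubs
    (hEx : ∀ (K : Type) [Field K] [NumberField K], (NumberField.IsTotallyReal K ∨ NumberField.IsCMField K) → ∀ (p : ℕ), Nat.Prime p → 3 ≤ p → ∀ (hcpt : Literature.NumberTheory.Automorphic.isCompact_glFiniteIntegralLevel p K) (π : Literature.NumberTheory.Automorphic.CuspidalAutomorphicRepData p K hcpt), π.1.IsLAlgebraic → (∃ T : Literature.NumberTheory.Automorphic.InfinityType K p, π.1.HasInfinityType T ∧ T.IsRegular) → ∀ (ℓ : ℕ) [Fact ℓ.Prime] (ι : PadicAlgCl ℓ ≃+* ℂ), ∃ ρ : Literature.NumberTheory.GaloisRepresentations.FramedGaloisRep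 K (PadicAlgCl ℓ) p, ∀ᶠ v : IsDedekindDomain.HeightOneSpectrum (NumberField.RingOfIntegers K) in Filter.cofinite, Summit.Langlands.SatakeFrobCompatibleAt ι π.1 ρ v)
    (hTorus : ∀ (K : Type) [Field K] [NumberField K], (NumberField.IsTotallyReal K ∨ NumberField.IsCMField K) → ∀ (p : ℕ), Nat.Prime p → 3 ≤ p → ∀ (hcpt : Literature.NumberTheory.Automorphic.isCompact_glFiniteIntegralLevel p K) (π : Literature.NumberTheory.Automorphic.CuspidalAutomorphicRepData p K hcpt), π.1.IsLAlgebraic → (∃ T : Literature.NumberTheory.Automorphic.InfinityType K p, π.1.HasInfinityType T ∧ T.IsRegular) → ∀ (ℓ₀ : ℕ) [Fact ℓ₀.Prime] (ι₀ : PadicAlgCl ℓ₀ ≃+* ℂ) (ρ₀ : Literature.NumberTheory.GaloisRepresentations.FramedGaloisRep K (PadicAlgCl ℓ₀) p), (∀ᶠ v : IsDedekindDomain.HeightOneSpectrum (NumberField.RingOfIntegers K) in Filter.cofinite, Summit.Langlands.SatakeFrobCompatibleAt ι₀ π.1 ρ₀ v) → ρ₀.toGaloisRep.IsIrreducible → ¬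 (∀ (F' : Type) [Field F'] [NumberField F'] [Algebra K F'], (ρ₀.restrictField F').toGaloisRep.IsIrreducible) → ∀ (ℓ : ℕ) [Fact ℓ.Prime] (ι : PadicAlgCl ℓ ≃+* ℂ) (ρ : Literature.NumberTheory.GaloisRepresentations.FramedGaloisRep K (PadicAlgCl ℓ) p), (∀ᶠ v : IsDedekindDomain.HeightOneSpectrum (NumberField.RingOfIntegers K) in Filter.cofinite, Summit.Langlands.SatakeFrobCompatibleAt ι π.1 ρ v) → ρ.toGaloisRep.IsIrreducible)
    (hLie : ∀ (K : Type) [Field K] [NumberField K], (NumberField.IsTotallyReal K ∨ NumberField.IsCMField K) → ∀ (p : ℕ), Nat.Prime p → 3 ≤ p → ∀ (hcpt : Literature.NumberTheory.Automorphic.isCompact_glFiniteIntegralLevel p K) (π : Literature.NumberTheory.Automorphic.CuspidalAutomorphicRepData p K hcpt), π.1.IsLAlgebraic → (∃ T : Literature.NumberTheory.Automorphic.InfinityType K p, π.1.HasInfinityType T ∧ T.IsRegular) → (∀ (h1 : Literature.NumberTheory.Automorphic.isCompact_glFiniteIntegralLevel 1 K) (η : Literature.NumberTheory.Automorphic.CuspidalAutomorphicRepData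 1 K h1), ¬ (∀ᶠ v : IsDedekindDomain.HeightOneSpectrum (NumberField.RingOfIntegers K) in Filter.cofinite, ∀ α : Multiset ℂ, π.1.HasSatakeParamAt v α → ∃ e : ℂ, η.1.HasSatakeParamAt v {e} ∧ α.map (fun a => a⁻¹) = α.map (fun a => e * a))) → ∀ (ℓ₀ : ℕ) [Fact ℓ₀.Prime] (ι₀ : PadicAlgCl ℓ₀ ≃+* ℂ) (ρ₀ : Literature.NumberTheory.GaloisRepresentations.FramedGaloisRep K (PadicAlgCl ℓ₀) p), (∀ᶠ v : IsDedekindDomain.HeightOneSpectrum (NumberField.RingOfIntegers K) in Filter.cofinite, Summit.Langlands.SatakeFrobCompatibleAt ι₀ π.1 ρ₀ v) → ρ₀.toGaloisRep.IsIrreducible → (∀ (F' : Type) [Field F'] [NumberField F'] [Algebra K F'], (ρ₀.restrictField F').toGaloisRep.IsIrreducible) → ∀ (ℓ : ℕ) [Fact ℓ.Prime] (ι : PadicAlgCl ℓ ≃+* ℂ) (ρ : Literature.NumberTheory.GaloisRepresentations.FramedGaloisRep K (PadicAlgCl ℓ) p), (∀ᶠ v : IsDedekindDomain.HeightOneSpectrum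 (NumberField.RingOfIntegers K) in Filter.cofinite, Summit.Langlands.SatakeFrobCompatibleAt ι π.1 ρ v) → ρ.toGaloisRep.IsIrreducible) :
    ∀ (K : Type) [Field K] [NumberField K], (NumberField.IsTotallyReal K ∨ NumberField.IsCMField K) → ∀ (p : ℕ), Nat.Prime p → 3 ≤ p → ∀ (hcpt : Literature.NumberTheory.Automorphic.isCompact_glFiniteIntegralLevel p K) (π : Literature.NumberTheory.Automorphic.CuspidalAutomorphicRepData p K hcpt), π.1.IsLAlgebraic → (∃ T : Literature.NumberTheory.Automorphic.InfinityType K p, π.1.HasInfinityType T ∧ T.IsRegular) → (∀ (h1 : Literature.NumberTheory.Automorphic.isCompact_glFiniteIntegralLevel 1 K) (η : Literature.NumberTheory.Automorphic.CuspidalAutomorphicRepData 1 K h1), ¬ (∀ᶠ v : IsDedekindDomain.HeightOneSpectrum (NumberField.RingOfIntegers K) in Filter.cofinite, ∀ α : Multiset ℂ, π.1.HasSatakeParamAt v α → ∃ e : ℂ, η.1.HasSatakeParamAt v {e} ∧ α.map (fun a => a⁻¹) = α.map (fun a => e * a))) → (∃ (ℓ₀ : ℕ) (_ : Fact ℓ₀.Prime)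 (ι₀ : PadicAlgCl ℓ₀ ≃+* ℂ), ∀ ρ₀ : Literature.NumberTheory.GaloisRepresentations.FramedGaloisRep K (PadicAlgCl ℓ₀) p, (∀ᶠ v : IsDedekindDomain.HeightOneSpectrum (NumberField.RingOfIntegers K) in Filter.cofinite, Summit.Langlands.SatakeFrobCompatibleAt ι₀ π.1 ρ₀ v) → ρ₀.toGaloisRep.IsIrreducible) → ∀ (ℓ : ℕ) [Fact ℓ.Prime] (ι : PadicAlgCl ℓ ≃+* ℂ) (ρ : Literature.NumberTheory.GaloisRepresentations.FramedGaloisRep K (PadicAlgCl ℓ) p), (∀ᶠ v : IsDedekindDomain.HeightOneSpectrum (NumberField.RingOfIntegers K) in Filter.cofinite, Summit.Langlands.SatakeFrobCompatibleAt ι π.1 ρ v) → ρ.toGaloisRep.IsIrreducible := by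
  intro K _ _ hK p hp h3 hcpt π hL hreg hnsd hgood ℓ _ ι ρ hρ
  obtain ⟨ℓ₀, hF₀, ι₀, hall⟩ := hgood
  haveI : Fact ℓ₀.Prime := hF₀
  -- the compatible partner at the good prime, irreducible by the crux hypothesis
  obtain ⟨ρ₀, hρ₀⟩ := hEx K hK p hp h3 hcpt π hL hreg ℓ₀ ι₀
  have hirr₀ : ρ₀.toGaloisRep.IsIrreducible := hall ρ₀ hρ₀
  -- case split: Lie-irreducible (irreducible on every open subgroup Γ_{F'}) or not
  by_cases hcase : ∀ (F' : Type) [Field F'] [NumberField F'] [Algebra K F'],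
      (ρ₀.restrictField F').toGaloisRep.IsIrreducible
  · exact hLie K hK p hp h3 hcpt π hL hreg hnsd ℓ₀ ι₀ ρ₀ hρ₀ hirr₀ hcase ℓ ι ρ hρ
  · exact hTorus K hK p hp h3 hcpt π hL hreg ℓ₀ ι₀ ρ₀ hρ₀ hirr₀ hcase ℓ ι ρ hρ

/-- **THE SKELETON THEOREM (registrar shape).** The crux
`Summit.Langlands.Langlands.Theses.OrdinaryPrimeTransport.PrimeRankTransport`, concluded BY NAME and
without hypotheses from the three declared stubs through the sorry-free assembly
`PrimeRankTransport_of_stubs`; the only `sorry`s in its closure are `stub_avatarExists`,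
`stub_torusCaseTransport`, `stub_lieIrreducibleTransport`. -/
theorem PrimeRankTransport_of : PrimeRankTransport :=
  PrimeRankTransport_of_stubs stub_avatarExists stub_torusCaseTransport stub_lieIrreducibleTransport

end Summit.Langlands.Langlands.Cruxes.PrimeRankTransport.Birth
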